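import Summits.CriticalPhenomena.PercolationContinuityZ3.Theorems.PercNearOneGluingNoHeavyLowerTailStarSetMixedComonotone
import Summits.CriticalPhenomena.PercolationContinuityZ3.Theorems.PercNearOneGluingNoHeavyLowerTailStarSetStateExpansion
import HarnessLib

/-!
# `NoHeavyLowerTail` (stmt-CriticalPhenomena-4575) — OES at level `j ≤ 2` for ANY two-port star multigraph, MIXED (MWF) certificate

Support file (prover `prim-gen-swap` gen 9; `--supports stmt-CriticalPhenomena-4575`).  No definitions, no named facts, no sorries.

**Theorem (`StarSet.setCS_twoPortStarMultigraph_mixed_levelTwo`).**  Pairwise distinct non-relay vertices `s i` (`i : Fin m`), star `i`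
joined (with positive weight) only to the two relays `p i = P (cls i) ≠ p' i = P' (cls i)` of its class `cls i : Fin (Mf + Mc)`; the
classes have pairwise distinct port pairs, the first `Mf` of them form a class forest listed in leaf-peeling order (`hforest`), the last
`Mc` ("chords") are arbitrary; `c ∈ A` off the ports with `μ(|π(port)| ≤ j) ≤ μ(|π(c)| ≤ j)` for every port; `j ≤ 2`; every `|A|`.
If the two explicit SUPPLY inequalities `hU0`, `hU1` of seat memo MWF-CERT.md §3 hold (U0'/U1'_r: the comonotone coefficient times
[nested forest coefficients `c_I` + chord prices `Θ_K·Zfar_K`] is covered by the comonotone coefficient plus the coefficients of the extreme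
words with at least three designated ports — for U1'_r only forest classes with `P_I ≠ r`, chords off `r`, and words not designating `r`),
then `μ(c ↮ S, 1 ≤ |π(S)| ≤ j) ≤ μ(c ↮ S, |π(c)| ≤ j)` for `S = {s i}`.
With `Mf = 0` this is `StarSet.setCS_twoPortStarMultigraph_pairRow_levelTwo`; with `Mc = 0` the supplies reduce to
`Σ_I c_I = 1 − Π_I(1 − Θ_I) ≤ 1 + budget`, which always holds, recovering `StarSet.setCS_twoPortStarClassForest_levelTwo`.
Ingredients: `StarSet.mixed_comonotone_budget`, `StarSet.gluedWord_nonneg`, `StarSet.setCSdiff_state_expansion`, `StarSet.extreme_regroup`.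
-/

noncomputable section

namespace Summit.CriticalPhenomena.PercolationContinuityZ3.Theorems

open MeasureTheory Set Literature.Probability.LatticeModels Literature.Probability.Percolation
open scoped Classical BigOperators

variable {n m Mf Mc : ℕ}

namespace StarSet

/-- **OES at level `j ≤ 2` for any two-port star multigraph under the mixed (MWF) supply inequalities.**  See the file header.
[cite: VandenbergHaggstromKahn2005, Thm. 1.5 (p. 7) — the only non-elementary input, via `observerSet_le_of_lonelier`] -/
theorem setCS_twoPortStarMultigraph_mixed_levelTwo (w : Sym2 (Fin n) → unitInterval) (A : Finset (Fin n)) (s p p' : Fin m → Fin n)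
    (cls : Fin m → Fin (Mf + Mc)) (P P' : Fin (Mf + Mc) → Fin n) (hP : ∀ i, p i = P (cls i)) (hP' : ∀ i, p' i = P' (cls i))
    (c : Fin n) (j : ℕ) (hj : j ≤ 2) (hs : Function.Injective s) (hsA : ∀ i, s i ∉ A)
    (hPA : ∀ I, P I ∈ A) (hP'A : ∀ I, P' I ∈ A) (hPP' : ∀ I, P I ≠ P' I)
    (hnopar : ∀ I K : Fin (Mf + Mc), I ≠ K → ¬ ((P K = P I ∨ P K = P' I) ∧ (P' K = P I ∨ P' K = P' I)))
    (hforest : ∀ K I : Fin Mf, K < I → P' (Fin.castAdd Mc K) ≠ P (Fin.castAdd Mc I) ∧ P' (Fin.castAdd Mc K) ≠ P' (Fin.castAdd Mc I))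
    (hcA : c ∈ A) (hcP : ∀ I, c ≠ P I ∧ c ≠ P' I)
    (hobs : ∀ i u, u ≠ s i → u ≠ p i → u ≠ p' i → w s(s i, u) = 0)
    (hdom : ∀ I,
      (prodBernoulli w).real {ω : BondConfig (Fin n) | (A.filter fun z => ω ∈ openConn (P I) z).card ≤ j} ≤
          (prodBernoulli w).real {ω : BondConfig (Fin n) | (A.filter fun z => ω ∈ openConn c z).card ≤ j} ∧
        (prodBernoulli w).real {ω : BondConfig (Fin n) | (A.filter fun z => ω ∈ openConn (P' I) z).card ≤ j} ≤
          (prodBernoulli w).real {ω : BondConfig (Fin n) | (A.filter fun z => ω ∈ openConn c z).card ≤ j})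
    (hU0 : (∏ i, (if (w s(s i, p i) : ℝ) * w s(s i, p' i) < 1 then
          ((1 - (w s(s i, p i) : ℝ)) * (1 - w s(s i, p' i))) / (1 - (w s(s i, p i) : ℝ) * w s(s i, p' i)) else 0)) *
        (∑ I : Fin Mf, ((1 - ∏ i ∈ Finset.univ.filter (fun i => cls i = Fin.castAdd Mc I), (1 - (w s(s i, p i) : ℝ) * w s(s i, p' i))) *
          ∏ K ∈ Finset.univ.filter (· < I), ∏ i ∈ Finset.univ.filter (fun i => cls i = Fin.castAdd Mc K), (1 - (w s(s i, p i) : ℝ) * w s(s i, p' i))) +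
        ∑ K : Fin Mc, ((1 - ∏ i ∈ Finset.univ.filter (fun i => cls i = Fin.natAdd Mf K), (1 - (w s(s i, p i) : ℝ) * w s(s i, p' i))) *
          ∏ κ' ∈ Finset.univ.filter (fun κ' => ¬ (P κ' = P (Fin.natAdd Mf K) ∨ P κ' = P' (Fin.natAdd Mf K) ∨
              P' κ' = P (Fin.natAdd Mf K) ∨ P' κ' = P' (Fin.natAdd Mf K))),
            ∏ i ∈ Finset.univ.filter (fun i => cls i = κ'), (1 - (w s(s i, p i) : ℝ) * w s(s i, p' i)))) ≤
      (∏ i, (if (w s(s i, p i) : ℝ) * w s(s i, p' i) < 1 then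
          ((1 - (w s(s i, p i) : ℝ)) * (1 - w s(s i, p' i))) / (1 - (w s(s i, p i) : ℝ) * w s(s i, p' i)) else 0)) +
      ∑ e : Fin m → Fin 3, (if 3 ≤ ((Finset.univ.filter fun i => e i = 1).image p ∪ (Finset.univ.filter fun i => e i = 2).image p').card then
        ∏ i, (if (w s(s i, p i) : ℝ) * w s(s i, p' i) < 1 then
            ((if e i = 1 then (w s(s i, p i) : ℝ) else 1 - w s(s i, p i)) *
              (if e i = 2 then (w s(s i, p' i) : ℝ) else 1 - w s(s i, p' i))) / (1 - (w s(s i, p i) : ℝ) * w s(s i, p' i))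
          else if e i = 1 then 1 else 0) else 0))
    (hU1 : ∀ r, (∏ i, (if (w s(s i, p i) : ℝ) * w s(s i, p' i) < 1 then
          ((1 - (w s(s i, p i) : ℝ)) * (1 - w s(s i, p' i))) / (1 - (w s(s i, p i) : ℝ) * w s(s i, p' i)) else 0)) *
        (∑ I ∈ (Finset.univ : Finset (Fin Mf)).filter (fun I => P (Fin.castAdd Mc I) ≠ r), ((1 - ∏ i ∈ Finset.univ.filter (fun i => cls i = Fin.castAdd Mc I), (1 - (w s(s i, p i) : ℝ) * w s(s i, p' i))) *
          ∏ K ∈ Finset.univ.filter (· < I), ∏ i ∈ Finset.univ.filter (fun i => cls i = Fin.castAdd Mc K), (1 - (w s(s i, p i) : ℝ) * w s(s i, p' i))) +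
        ∑ K ∈ (Finset.univ : Finset (Fin Mc)).filter (fun K => P (Fin.natAdd Mf K) ≠ r ∧ P' (Fin.natAdd Mf K) ≠ r), ((1 - ∏ i ∈ Finset.univ.filter (fun i => cls i = Fin.natAdd Mf K), (1 - (w s(s i, p i) : ℝ) * w s(s i, p' i))) *
          ∏ κ' ∈ Finset.univ.filter (fun κ' => ¬ (P κ' = P (Fin.natAdd Mf K) ∨ P κ' = P' (Fin.natAdd Mf K) ∨
              P' κ' = P (Fin.natAdd Mf K) ∨ P' κ' = P' (Fin.natAdd Mf K))),
            ∏ i ∈ Finset.univ.filter (fun i => cls i = κ'), (1 - (w s(s i, p i) : ℝ) * w s(s i, p' i)))) ≤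
      (∏ i, (if (w s(s i, p i) : ℝ) * w s(s i, p' i) < 1 then
          ((1 - (w s(s i, p i) : ℝ)) * (1 - w s(s i, p' i))) / (1 - (w s(s i, p i) : ℝ) * w s(s i, p' i)) else 0)) +
      ∑ e ∈ (Finset.univ : Finset (Fin m → Fin 3)).filter (fun e =>
          r ∉ (Finset.univ.filter fun i => e i = 1).image p ∪ (Finset.univ.filter fun i => e i = 2).image p'),
        (if 3 ≤ ((Finset.univ.filter fun i => e i = 1).image p ∪ (Finset.univ.filter fun i => e i = 2).image p').card then
          ∏ i, (if (w s(s i, p i) : ℝ) * w s(s i, p' i) < 1 then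
            ((if e i = 1 then (w s(s i, p i) : ℝ) else 1 - w s(s i, p i)) *
              (if e i = 2 then (w s(s i, p' i) : ℝ) else 1 - w s(s i, p' i))) / (1 - (w s(s i, p i) : ℝ) * w s(s i, p' i))
          else if e i = 1 then 1 else 0) else 0)) :
    (prodBernoulli w).real {ω : BondConfig (Fin n) | (∀ x ∈ Finset.univ.image s, ω ∉ openConn c x) ∧
        1 ≤ (A.filter fun z => ∃ x ∈ Finset.univ.image s, ω ∈ openConn x z).card ∧
        (A.filter fun z => ∃ x ∈ Finset.univ.image s, ω ∈ openConn x z).card ≤ j} ≤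
      (prodBernoulli w).real {ω : BondConfig (Fin n) | (∀ x ∈ Finset.univ.image s, ω ∉ openConn c x) ∧
        (A.filter fun z => ω ∈ openConn c z).card ≤ j} := by
  -- star-level facts
  have hpA : ∀ i, p i ∈ A := fun i => (hP i) ▸ hPA (cls i)
  have hp'A : ∀ i, p' i ∈ A := fun i => (hP' i) ▸ hP'A (cls i)
  have hpp' : ∀ i, p i ≠ p' i := fun i => by rw [hP i, hP' i]; exact hPP' (cls i)
  have hcp : ∀ i, c ≠ p i ∧ c ≠ p' i := fun i => by rw [hP i, hP' i]; exact hcP (cls i)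
  have hdomStar : ∀ i,
      (prodBernoulli w).real {ω : BondConfig (Fin n) | (A.filter fun z => ω ∈ openConn (p i) z).card ≤ j} ≤
          (prodBernoulli w).real {ω : BondConfig (Fin n) | (A.filter fun z => ω ∈ openConn c z).card ≤ j} ∧
        (prodBernoulli w).real {ω : BondConfig (Fin n) | (A.filter fun z => ω ∈ openConn (p' i) z).card ≤ j} ≤
          (prodBernoulli w).real {ω : BondConfig (Fin n) | (A.filter fun z => ω ∈ openConn c z).card ≤ j} := by
    intro i; rw [hP i, hP' i]; exact hdom (cls i)
  have hps : ∀ i k, p i ≠ s k := fun i k h => hsA k (h ▸ hpA i)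
  have hp's : ∀ i k, p' i ≠ s k := fun i k h => hsA k (h ▸ hp'A i)
  have hcs : ∀ i, c ≠ s i := fun i h => hsA i (h ▸ hcA)
  -- abbreviations for the words
  set θ : Fin m → ℝ := fun i => (w s(s i, p i) : ℝ) * w s(s i, p' i) with hθ
  set coef : (Fin m → Fin 3) → ℝ := fun e => ∏ i, (if (w s(s i, p i) : ℝ) * w s(s i, p' i) < 1 then
      ((if e i = 1 then (w s(s i, p i) : ℝ) else 1 - w s(s i, p i)) *
        (if e i = 2 then (w s(s i, p' i) : ℝ) else 1 - w s(s i, p' i))) / (1 - (w s(s i, p i) : ℝ) * w s(s i, p' i))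
      else if e i = 1 then 1 else 0) with hcoef
  have hcoefnn : ∀ e, 0 ≤ coef e := fun e => Finset.prod_nonneg fun i _ =>
    extremeCoeff_nonneg _ _ (w _).2.1 (w _).2.2 (w _).2.1 (w _).2.2 (e i)
  set Rw : (Fin m → Fin 3) → Finset (Fin n) := fun e =>
    (Finset.univ.filter fun i => e i = 1).image p ∪ (Finset.univ.filter fun i => e i = 2).image p' with hRw
  set b : (Fin m → Fin 3) → ℝ := fun e => if 3 ≤ (Rw e).card then coef e else 0 with hb
  have hbnn : ∀ e, 0 ≤ b e := fun e => by simp only [hb]; split_ifs; exacts [hcoefnn e, le_refl 0]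
  set e₀ : Fin m → Fin 3 := fun _ => 0 with he₀
  have hcoef0 : coef e₀ = ∏ i, (if (w s(s i, p i) : ℝ) * w s(s i, p' i) < 1 then
      ((1 - (w s(s i, p i) : ℝ)) * (1 - w s(s i, p' i))) / (1 - (w s(s i, p i) : ℝ) * w s(s i, p' i)) else 0) := by
    simp only [hcoef, he₀]
    refine Finset.prod_congr rfl fun i _ => ?_
    simp
  -- the state expansion and the extreme regrouping
  rw [← sub_nonneg, setCSdiff_state_expansion w A s p p' c j hs hsA hps hp's hpp' hcs hobs]
  have hre := extreme_regroup (fun i => (w s(s i, p i) : ℝ)) (fun i => (w s(s i, p' i) : ℝ)) (fun i => (w _).2.1)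
    (fun i => (w _).2.2) (fun i => (w _).2.1) (fun i => (w _).2.2)
    (fun t => (prodBernoulli w).real {ω : BondConfig (Fin n) |
        (∀ u ∈ (Finset.univ.filter fun i => (t i).1 = true).image p ∪ (Finset.univ.filter fun i => (t i).2 = true).image p',
          ¬ (openGraph (ω ∩ {e | ∀ v ∈ Finset.univ.image s, v ∉ e})).Reachable c u) ∧
        (A.filter fun z => (openGraph (ω ∩ {e | ∀ v ∈ Finset.univ.image s, v ∉ e})).Reachable c z).card ≤ j} -
      (prodBernoulli w).real {ω : BondConfig (Fin n) |
        (∀ u ∈ (Finset.univ.filter fun i => (t i).1 = true).image p ∪ (Finset.univ.filter fun i => (t i).2 = true).image p',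
          ¬ (openGraph (ω ∩ {e | ∀ v ∈ Finset.univ.image s, v ∉ e})).Reachable c u) ∧
        1 ≤ (A.filter fun z => ∃ u ∈ (Finset.univ.filter fun i => (t i).1 = true).image p ∪
            (Finset.univ.filter fun i => (t i).2 = true).image p',
          (openGraph (ω ∩ {e | ∀ v ∈ Finset.univ.image s, v ∉ e})).Reachable u z).card ∧
        (A.filter fun z => ∃ u ∈ (Finset.univ.filter fun i => (t i).1 = true).image p ∪
            (Finset.univ.filter fun i => (t i).2 = true).image p',
          (openGraph (ω ∩ {e | ∀ v ∈ Finset.univ.image s, v ∉ e})).Reachable u z).card ≤ j})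
  beta_reduce at hre
  rw [hre]
  -- the word of `e`
  set Word : (Fin m → Fin 3) → ℝ := fun e => ∑ σ ∈ (Finset.univ : Finset (Fin m)).powerset,
    ((∏ i ∈ σ, (w s(s i, p i) : ℝ) * w s(s i, p' i)) * ∏ i ∈ Finset.univ \ σ, (1 - (w s(s i, p i) : ℝ) * w s(s i, p' i))) *
    ((prodBernoulli w).real {ω : BondConfig (Fin n) |
        (∀ u ∈ (Finset.univ.filter fun i => (if i ∈ σ then (true, true) else (decide (e i = 1), decide (e i = 2))).1 = true).image p ∪
            (Finset.univ.filter fun i => (if i ∈ σ then (true, true) else (decide (e i = 1), decide (e i = 2))).2 = true).image p',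
          ¬ (openGraph (ω ∩ {e | ∀ v ∈ Finset.univ.image s, v ∉ e})).Reachable c u) ∧
        (A.filter fun z => (openGraph (ω ∩ {e | ∀ v ∈ Finset.univ.image s, v ∉ e})).Reachable c z).card ≤ j} -
      (prodBernoulli w).real {ω : BondConfig (Fin n) |
        (∀ u ∈ (Finset.univ.filter fun i => (if i ∈ σ then (true, true) else (decide (e i = 1), decide (e i = 2))).1 = true).image p ∪
            (Finset.univ.filter fun i => (if i ∈ σ then (true, true) else (decide (e i = 1), decide (e i = 2))).2 = true).image p',
          ¬ (openGraph (ω ∩ {e | ∀ v ∈ Finset.univ.image s, v ∉ e})).Reachable c u) ∧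
        1 ≤ (A.filter fun z => ∃ u ∈ (Finset.univ.filter fun i =>
              (if i ∈ σ then (true, true) else (decide (e i = 1), decide (e i = 2))).1 = true).image p ∪
            (Finset.univ.filter fun i => (if i ∈ σ then (true, true) else (decide (e i = 1), decide (e i = 2))).2 = true).image p',
          (openGraph (ω ∩ {e | ∀ v ∈ Finset.univ.image s, v ∉ e})).Reachable u z).card ∧
        (A.filter fun z => ∃ u ∈ (Finset.univ.filter fun i =>
              (if i ∈ σ then (true, true) else (decide (e i = 1), decide (e i = 2))).1 = true).image p ∪
            (Finset.univ.filter fun i => (if i ∈ σ then (true, true) else (decide (e i = 1), decide (e i = 2))).2 = true).image p',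
          (openGraph (ω ∩ {e | ∀ v ∈ Finset.univ.image s, v ∉ e})).Reachable u z).card ≤ j}) with hWord
  change 0 ≤ ∑ e : Fin m → Fin 3, coef e * Word e
  -- membership in the gate set of `(e, σ)`
  have hgate : ∀ (e : Fin m → Fin 3) (σ : Finset (Fin m)) (u : Fin n),
      u ∈ (Finset.univ.filter fun i => (if i ∈ σ then (true, true) else (decide (e i = 1), decide (e i = 2))).1 = true).image p ∪
        (Finset.univ.filter fun i => (if i ∈ σ then (true, true) else (decide (e i = 1), decide (e i = 2))).2 = true).image p' ↔
      u ∈ Rw e ∨ u ∈ σ.image p ∪ σ.image p' := by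
    intro e σ u
    simp only [hRw, Finset.mem_union, Finset.mem_image, Finset.mem_filter, Finset.mem_univ, true_and]
    constructor
    · rintro (⟨i, hi, rfl⟩ | ⟨i, hi, rfl⟩)
      · by_cases hiσ : i ∈ σ
        · exact Or.inr (Or.inl ⟨i, hiσ, rfl⟩)
        · simp only [hiσ, if_false, decide_eq_true_eq] at hi
          exact Or.inl (Or.inl ⟨i, hi, rfl⟩)
      · by_cases hiσ : i ∈ σ
        · exact Or.inr (Or.inr ⟨i, hiσ, rfl⟩)
        · simp only [hiσ, if_false, decide_eq_true_eq] at hi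
          exact Or.inl (Or.inr ⟨i, hi, rfl⟩)
    · rintro ((⟨i, hi, rfl⟩ | ⟨i, hi, rfl⟩) | (⟨i, hi, rfl⟩ | ⟨i, hi, rfl⟩))
      · refine Or.inl ⟨i, ?_, rfl⟩
        by_cases hiσ : i ∈ σ
        · simp [hiσ]
        · simp [hiσ, hi]
      · refine Or.inr ⟨i, ?_, rfl⟩
        by_cases hiσ : i ∈ σ
        · simp [hiσ]
        · simp [hiσ, hi]
      · exact Or.inl ⟨i, by simp [hi], rfl⟩
      · exact Or.inr ⟨i, by simp [hi], rfl⟩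
  -- (1) glued words are nonnegative
  have hglued : ∀ e : Fin m → Fin 3, e ≠ e₀ → 0 ≤ Word e := by
    intro e he
    obtain ⟨i₀, hi₀⟩ : ∃ i₀, e i₀ ≠ 0 := by
      by_contra h
      push Not at h
      exact he (funext fun i => by rw [h i])
    exact gluedWord_nonneg w A s p p' c j hj hs hsA hpA hp'A hpp' hcA hcp hobs hdomStar e i₀ hi₀ _ (fun σ u => hgate e σ u)
  -- (2) words with at least three designated ports are the budget cells
  set BW : (Fin m → Fin 3) → ℝ := fun e => ∑ S ∈ (Finset.univ : Finset (Fin (Mf + Mc))).powerset,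
    ((∏ K ∈ S, (1 - ∏ i ∈ Finset.univ.filter (fun i => cls i = K), (1 - (w s(s i, p i) : ℝ) * w s(s i, p' i)))) *
      ∏ K ∈ Finset.univ \ S, ∏ i ∈ Finset.univ.filter (fun i => cls i = K), (1 - (w s(s i, p i) : ℝ) * w s(s i, p' i))) *
    (prodBernoulli w).real {ω : BondConfig (Fin n) |
        (∀ u ∈ Rw e ∪ (S.image P ∪ S.image P'), ¬ (openGraph (ω ∩ {e | ∀ v ∈ Finset.univ.image s, v ∉ e})).Reachable c u) ∧
        (A.filter fun z => (openGraph (ω ∩ {e | ∀ v ∈ Finset.univ.image s, v ∉ e})).Reachable c z).card ≤ j} with hBW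
  have hRwA : ∀ e, ∀ u ∈ Rw e, u ∈ A := by
    intro e u hu
    simp only [hRw, Finset.mem_union, Finset.mem_image, Finset.mem_filter, Finset.mem_univ, true_and] at hu
    rcases hu with ⟨i, -, rfl⟩ | ⟨i, -, rfl⟩
    · exact hpA i
    · exact hp'A i
  have hbig : ∀ e : Fin m → Fin 3, 3 ≤ (Rw e).card → Word e = BW e := by
    intro e hcard
    -- the lonely cell is empty, the light cell is the budget cell of `Rw e`
    have hterm : ∀ σ : Finset (Fin m),
        (prodBernoulli w).real {ω : BondConfig (Fin n) |
            (∀ u ∈ (Finset.univ.filter fun i => (if i ∈ σ then (true, true) else (decide (e i = 1), decide (e i = 2))).1 = true).image p ∪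
                (Finset.univ.filter fun i => (if i ∈ σ then (true, true) else (decide (e i = 1), decide (e i = 2))).2 = true).image p',
              ¬ (openGraph (ω ∩ {e | ∀ v ∈ Finset.univ.image s, v ∉ e})).Reachable c u) ∧
            (A.filter fun z => (openGraph (ω ∩ {e | ∀ v ∈ Finset.univ.image s, v ∉ e})).Reachable c z).card ≤ j} -
          (prodBernoulli w).real {ω : BondConfig (Fin n) |
            (∀ u ∈ (Finset.univ.filter fun i => (if i ∈ σ then (true, true) else (decide (e i = 1), decide (e i = 2))).1 = true).image p ∪
                (Finset.univ.filter fun i => (if i ∈ σ then (true, true) else (decide (e i = 1), decide (e i = 2))).2 = true).image p',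
              ¬ (openGraph (ω ∩ {e | ∀ v ∈ Finset.univ.image s, v ∉ e})).Reachable c u) ∧
            1 ≤ (A.filter fun z => ∃ u ∈ (Finset.univ.filter fun i =>
                  (if i ∈ σ then (true, true) else (decide (e i = 1), decide (e i = 2))).1 = true).image p ∪
                (Finset.univ.filter fun i => (if i ∈ σ then (true, true) else (decide (e i = 1), decide (e i = 2))).2 = true).image p',
              (openGraph (ω ∩ {e | ∀ v ∈ Finset.univ.image s, v ∉ e})).Reachable u z).card ∧
            (A.filter fun z => ∃ u ∈ (Finset.univ.filter fun i =>
                  (if i ∈ σ then (true, true) else (decide (e i = 1), decide (e i = 2))).1 = true).image p ∪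
                (Finset.univ.filter fun i => (if i ∈ σ then (true, true) else (decide (e i = 1), decide (e i = 2))).2 = true).image p',
              (openGraph (ω ∩ {e | ∀ v ∈ Finset.univ.image s, v ∉ e})).Reachable u z).card ≤ j} =
        (prodBernoulli w).real {ω : BondConfig (Fin n) |
            (∀ u ∈ Rw e ∪ ((σ.image cls).image P ∪ (σ.image cls).image P'),
              ¬ (openGraph (ω ∩ {e | ∀ v ∈ Finset.univ.image s, v ∉ e})).Reachable c u) ∧
            (A.filter fun z => (openGraph (ω ∩ {e | ∀ v ∈ Finset.univ.image s, v ∉ e})).Reachable c z).card ≤ j} := by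
      intro σ
      have hempty : {ω : BondConfig (Fin n) |
            (∀ u ∈ (Finset.univ.filter fun i => (if i ∈ σ then (true, true) else (decide (e i = 1), decide (e i = 2))).1 = true).image p ∪
                (Finset.univ.filter fun i => (if i ∈ σ then (true, true) else (decide (e i = 1), decide (e i = 2))).2 = true).image p',
              ¬ (openGraph (ω ∩ {e | ∀ v ∈ Finset.univ.image s, v ∉ e})).Reachable c u) ∧
            1 ≤ (A.filter fun z => ∃ u ∈ (Finset.univ.filter fun i =>
                  (if i ∈ σ then (true, true) else (decide (e i = 1), decide (e i = 2))).1 = true).image p ∪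
                (Finset.univ.filter fun i => (if i ∈ σ then (true, true) else (decide (e i = 1), decide (e i = 2))).2 = true).image p',
              (openGraph (ω ∩ {e | ∀ v ∈ Finset.univ.image s, v ∉ e})).Reachable u z).card ∧
            (A.filter fun z => ∃ u ∈ (Finset.univ.filter fun i =>
                  (if i ∈ σ then (true, true) else (decide (e i = 1), decide (e i = 2))).1 = true).image p ∪
                (Finset.univ.filter fun i => (if i ∈ σ then (true, true) else (decide (e i = 1), decide (e i = 2))).2 = true).image p',
              (openGraph (ω ∩ {e | ∀ v ∈ Finset.univ.image s, v ∉ e})).Reachable u z).card ≤ j} = ∅ := by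
        ext ω
        simp only [mem_setOf_eq, mem_empty_iff_false, iff_false, not_and, not_le]
        intro _ _
        refine lt_of_lt_of_le (lt_of_lt_of_le (by omega : j < 3) hcard) (Finset.card_le_card fun z hz => ?_)
        exact Finset.mem_filter.2 ⟨hRwA e z hz, z, (hgate e σ z).2 (Or.inl hz), SimpleGraph.Reachable.refl _⟩
      have hset : {ω : BondConfig (Fin n) |
            (∀ u ∈ (Finset.univ.filter fun i => (if i ∈ σ then (true, true) else (decide (e i = 1), decide (e i = 2))).1 = true).image p ∪
                (Finset.univ.filter fun i => (if i ∈ σ then (true, true) else (decide (e i = 1), decide (e i = 2))).2 = true).image p',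
              ¬ (openGraph (ω ∩ {e | ∀ v ∈ Finset.univ.image s, v ∉ e})).Reachable c u) ∧
            (A.filter fun z => (openGraph (ω ∩ {e | ∀ v ∈ Finset.univ.image s, v ∉ e})).Reachable c z).card ≤ j} =
          {ω : BondConfig (Fin n) |
            (∀ u ∈ Rw e ∪ ((σ.image cls).image P ∪ (σ.image cls).image P'),
              ¬ (openGraph (ω ∩ {e | ∀ v ∈ Finset.univ.image s, v ∉ e})).Reachable c u) ∧
            (A.filter fun z => (openGraph (ω ∩ {e | ∀ v ∈ Finset.univ.image s, v ∉ e})).Reachable c z).card ≤ j} := by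
        ext ω
        simp only [mem_setOf_eq]
        have hmem : ∀ u, (u ∈ (Finset.univ.filter fun i => (if i ∈ σ then (true, true) else (decide (e i = 1), decide (e i = 2))).1 = true).image p ∪
            (Finset.univ.filter fun i => (if i ∈ σ then (true, true) else (decide (e i = 1), decide (e i = 2))).2 = true).image p') ↔
            u ∈ Rw e ∪ ((σ.image cls).image P ∪ (σ.image cls).image P') := by
          intro u
          rw [hgate e σ u, ← portPattern_eq_classPattern p p' cls P P' hP hP' σ]
          simp only [Finset.mem_union]
        constructor
        · rintro ⟨h1, h2⟩; exact ⟨fun u hu => h1 u ((hmem u).2 hu), h2⟩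
        · rintro ⟨h1, h2⟩; exact ⟨fun u hu => h1 u ((hmem u).1 hu), h2⟩
      rw [hempty, hset, measureReal_empty, sub_zero]
    simp only [hWord, hBW]
    rw [Finset.sum_congr rfl fun σ _ => by rw [hterm σ]]
    exact linkSum_pushforward θ cls (fun S => (prodBernoulli w).real {ω : BondConfig (Fin n) |
      (∀ u ∈ Rw e ∪ (S.image P ∪ S.image P'), ¬ (openGraph (ω ∩ {e | ∀ v ∈ Finset.univ.image s, v ∉ e})).Reachable c u) ∧
      (A.filter fun z => (openGraph (ω ∩ {e | ∀ v ∈ Finset.univ.image s, v ∉ e})).Reachable c z).card ≤ j})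
  -- (3) the comonotone word in class form
  set CW : ℝ := ∑ S ∈ (Finset.univ : Finset (Fin (Mf + Mc))).powerset,
    ((∏ K ∈ S, (1 - ∏ i ∈ Finset.univ.filter (fun i => cls i = K), (1 - (w s(s i, p i) : ℝ) * w s(s i, p' i)))) *
      ∏ K ∈ Finset.univ \ S, ∏ i ∈ Finset.univ.filter (fun i => cls i = K), (1 - (w s(s i, p i) : ℝ) * w s(s i, p' i))) *
    ((prodBernoulli w).real {ω : BondConfig (Fin n) |
        (∀ u ∈ S.image P ∪ S.image P', ¬ (openGraph (ω ∩ {e | ∀ v ∈ Finset.univ.image s, v ∉ e})).Reachable c u) ∧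
        (A.filter fun z => (openGraph (ω ∩ {e | ∀ v ∈ Finset.univ.image s, v ∉ e})).Reachable c z).card ≤ j} -
      (prodBernoulli w).real {ω : BondConfig (Fin n) |
        (∀ u ∈ S.image P ∪ S.image P', ¬ (openGraph (ω ∩ {e | ∀ v ∈ Finset.univ.image s, v ∉ e})).Reachable c u) ∧
        1 ≤ (A.filter fun z => ∃ u ∈ S.image P ∪ S.image P',
          (openGraph (ω ∩ {e | ∀ v ∈ Finset.univ.image s, v ∉ e})).Reachable u z).card ∧
        (A.filter fun z => ∃ u ∈ S.image P ∪ S.image P',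
          (openGraph (ω ∩ {e | ∀ v ∈ Finset.univ.image s, v ∉ e})).Reachable u z).card ≤ j}) with hCW
  have hword0 : Word e₀ = CW := by
    have hY : ∀ σ : Finset (Fin m),
        (Finset.univ.filter fun i => (if i ∈ σ then (true, true) else (decide (e₀ i = 1), decide (e₀ i = 2))).1 = true).image p ∪
          (Finset.univ.filter fun i => (if i ∈ σ then (true, true) else (decide (e₀ i = 1), decide (e₀ i = 2))).2 = true).image p' =
        (σ.image cls).image P ∪ (σ.image cls).image P' := by
      intro σ
      rw [← portPattern_eq_classPattern p p' cls P P' hP hP' σ]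
      ext u
      rw [hgate e₀ σ u]
      have hR0 : Rw e₀ = ∅ := by simp [hRw, he₀]
      simp [hR0]
    simp only [hWord, hCW, hY]
    exact linkSum_pushforward θ cls (fun S => (prodBernoulli w).real {ω : BondConfig (Fin n) |
        (∀ u ∈ S.image P ∪ S.image P', ¬ (openGraph (ω ∩ {e | ∀ v ∈ Finset.univ.image s, v ∉ e})).Reachable c u) ∧
        (A.filter fun z => (openGraph (ω ∩ {e | ∀ v ∈ Finset.univ.image s, v ∉ e})).Reachable c z).card ≤ j} -
      (prodBernoulli w).real {ω : BondConfig (Fin n) |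
        (∀ u ∈ S.image P ∪ S.image P', ¬ (openGraph (ω ∩ {e | ∀ v ∈ Finset.univ.image s, v ∉ e})).Reachable c u) ∧
        1 ≤ (A.filter fun z => ∃ u ∈ S.image P ∪ S.image P',
          (openGraph (ω ∩ {e | ∀ v ∈ Finset.univ.image s, v ∉ e})).Reachable u z).card ∧
        (A.filter fun z => ∃ u ∈ S.image P ∪ S.image P',
          (openGraph (ω ∩ {e | ∀ v ∈ Finset.univ.image s, v ∉ e})).Reachable u z).card ≤ j})
  -- (4) the budget inequality
  have hRport : ∀ e, ∀ u ∈ Rw e, ∃ I, u = P I ∨ u = P' I := by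
    intro e u hu
    simp only [hRw, Finset.mem_union, Finset.mem_image, Finset.mem_filter, Finset.mem_univ, true_and] at hu
    rcases hu with ⟨i, -, rfl⟩ | ⟨i, -, rfl⟩
    · exact ⟨cls i, Or.inl (hP i)⟩
    · exact ⟨cls i, Or.inr (hP' i)⟩
  have hU0' := hU0
  have hU1' := hU1
  rw [← hcoef0] at hU0' hU1'
  have key := mixed_comonotone_budget w A s p p' cls P P' hP hP' c j hj hs hsA hPA hP'A hPP' hnopar hforest hcA hcP hobs
    (fun κ => (hdom κ).1) (coef e₀) (hcoefnn e₀) b hbnn Rw hRport hU0' (fun r => hU1' r)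
  -- (5) assemble: Σ_e coef e · Word e ≥ coef e₀ · CW + Σ_e b e · BW e ≥ 0
  have hlow : ∀ e, e ≠ e₀ → b e * BW e ≤ coef e * Word e := by
    intro e he
    by_cases hcard : 3 ≤ (Rw e).card
    · simp only [hb, if_pos hcard]; rw [hbig e hcard]
    · simp only [hb, if_neg hcard, zero_mul]; exact mul_nonneg (hcoefnn e) (hglued e he)
  have hb0 : b e₀ = 0 := by
    have hR0 : Rw e₀ = ∅ := by simp [hRw, he₀]
    simp [hb, hR0]
  calc (0 : ℝ) ≤ coef e₀ * CW + ∑ e, b e * BW e := key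
    _ = coef e₀ * Word e₀ + ∑ e ∈ Finset.univ.erase e₀, b e * BW e := by
        rw [hword0, ← Finset.add_sum_erase Finset.univ (fun e => b e * BW e) (Finset.mem_univ e₀), hb0, zero_mul, zero_add]
    _ ≤ coef e₀ * Word e₀ + ∑ e ∈ Finset.univ.erase e₀, coef e * Word e :=
        add_le_add le_rfl (Finset.sum_le_sum fun e he => hlow e (Finset.ne_of_mem_erase he))
    _ = ∑ e, coef e * Word e := Finset.add_sum_erase Finset.univ (fun e => coef e * Word e) (Finset.mem_univ e₀)

end StarSet

end Summit.CriticalPhenomena.PercolationContinuityZ3.Theorems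

end
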